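import Summits.RiemannHypothesis.RiemannHypothesis.Theorems.TiltedLandingLaw421R3Lens1ToothNestUmbrella

/-!
# TiltedLandingLaw421R3 — lens-1 (N″c) «ToothDichotomy» IMAGE v2: `ToothDichotomyQ θ` (a′), `ToothOnlyDichotomyQ`, RV(κ₁) pair (OPEN laws), (K) glue

W-09 lens-1 (rh33346-lens-1 g10). IMAGE of the sketch of record v2 (`ToothDichotomy-SKETCH-v2.lean` 3c398da2570258e4; director-rh g30 (CA1009)(2)
consolidation of (N″c), typing word (CA1011)(2) «second branch = `TiltReady`'s body VERBATIM, non-strict», image word (CA1014)(2); C2 rh-idea-2 g57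
RESULT-10/11/12 typing + float adversary; C6 rh-idea-4 g45 PART 2/3 exact; tenure g21 (q3) LINE 10) — IMAGE v1 af18e24c62ad70c2 plus the critic's
TYPING WORD (rh-split-ref-2 g31, HANDS 124 v1, kernel-checked V1/V1′/V4) as ruled (CA1028)(2)/(CA1029): see «v2 ERRATUM» below; this docblock new.
ONE import = the TREE module #1271 `…R3Lens1ToothNestUmbrella` (lens-1's 119: `RestFactor`, `RVClass`, `p₃`, `ToothNestUmbrellaAQ`,
`restFactor_of_zeros`, `umbrella_dispatch`), which carries #1262 `…R3UnionShadow` and #1264 `…R3Lens1ToothNest`; namespace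
`RhW08.Lens1ToothNestUmbrella` reopened. SUPPORT (K-only): the four laws are `def … : Prop`, asserted by NOTHING here; every theorem is glue. No
stub is closed by this file.

THE LAW-CANDIDATE OF RECORD (a) `ToothDichotomyQ θ` for stub 2′'s umbrella sub-case (C2's CLASS-FREE typing): on a legal frame (`EngineHyps5 2 …`),
let `T` be a level-`j` band state (`StTrkDQ … j T`) with every level-`j` band state of height `≤ Im T` and NO strictly taller toucher
(`RhW08.Lens1Pinning.NoTallerToucher f j T` — the clause (CA1002)(4) adds to `UmbrellaLow`, tenure's `UmbrellaLowNT`), `b` a θ-low toucher (`f⁽ʲ⁾ b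
= 0`, `(1 − θ)·Im T ≤ Im b ≤ Im T`, `|Re T − Re b| ≤ Im T + Im b`, `¬ StTrkDQ … j b` (NOT a band state: beyond the wall), `PinnedTopAt f j b` — ALL
the `UmbrellaLow θ` partner clauses, v2) and `t : ℝ` a tooth (`f⁽ʲ⁾ t = 0`) with `|t − Re T| ≤ Im T/2`; then EITHER some zero `w` of `f⁽ʲ⁺¹⁾` with
`0 < Im w` lies in `T`'s CLOSED Jensen disc (`RhW08.QuadW.NestedStep T w`) OR `f⁽ʲ⁾` has a Newton–Laguerre event `x` on the axis (`NLEventOf f j x`,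
…Seam01, closed sign form) with `|x − x₀| < (j+3)·R/2` (the `TiltReady` range, verbatim) and `|x − Re T| ≤ 2·Im T`. NO drift window, NO rest-field
class, NO anchor, NO depth constant. It is a cluster law of 1′/2′ type (S-typed: as hard as the stub on its sub-case, reaching everything benched),
not an M lemma.

v2 ERRATUM (critic's typing word, CORRECT): in v1 the partner `b` carried only the four clauses `f⁽ʲ⁾ b = 0`, `(1−θ)·Im T ≤ Im b ≤ Im T`, `|Re T −
Re b| ≤ Im T + Im b`, which `b := T` DISCHARGES (`hT.2.1`, `hT.2.2.1`, θ ≥ 0), so v1's `ToothDichotomyQ θ` was, as a proposition, the θ-free and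
b-free TOOTH-ONLY dichotomy (the umbrella datum's binders `¬ StTrkDQ … j b`, `PinnedTopAt f j b` had been dropped in the abstraction — an error
against the weakest-law rule (CA1011)(2)). v2 carries BOTH sentences, each honest: (a′) `ToothDichotomyQ θ` WITH the two binders (θ and `b` bite; `b
≠ T` is forced since `T` is a band state) = 2′-NT's near-tooth umbrella sub-case LITERALLY = the PRIMARY law-candidate of record / certificate
target; and the STRONGER CONJECTURE `ToothOnlyDichotomyQ` (no partner at all) with the (K) weakening `toothDichotomyQ_of_toothOnly` (ignore `b`).
The clauses `NoTallerToucher f j T`, the tooth clauses and the radius `|x − Re T| ≤ 2·Im T` are SCOPE clauses of the laws — they restrict what is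
asserted and are consumed by no dispatcher (critic's mutants (a)/(b)/(c)). The `b := T` test does NOT collapse (ii)/(iii): there `b` is a genuine
factor of `f⁽ʲ⁾` (`RestFactor`/`RestFactor4`), so `b := T` is the double-top special case (branch 1 with `w := T`), not an equivalent of the law —
no binder inserted in (ii)/(iii).

THE CERTIFIABLE SUB-CASE PAIR (b) in the rest-factor class RV(κ₁) of 119 (`RVClass κ₁ T H`: `H ≠ 0` on `D⁺(T)` and `Im T²·‖(H′/H)′‖ ≤ κ₁` there),
same second branch, NO drift datum: (ii) `ToothNestDichotomyQ θ κ₁` — 119's binders (`0 < Im T`, θ-band partner touching, near tooth `|t − Re T| ≤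
Im T/2`, `RestFactor f j T b t H`) MINUS the drift bound; (iii) `UmbrellaDichotomyQ θ κ₁` — NO tooth, four-body `RestFactor4 f j T b H` (`f⁽ʲ⁾ =
(z−T)(z−T̄)(z−b)(z−b̄)·H`). (ii) and (iii) PARTITION the toothed configurations by tooth distance at `κ₁ = 1` (a tooth at distance `u` from `D⁺(T)`
loads `κ₁` by `≈ Im T²/(u² + (Im T/16)²)`); 119's `ToothNestUmbrellaAQ θ κ₁ d` is the certified drift-window instance under (ii)
(`dichotomy_of_umbrellaA`). Proposed instance of record `κ₁ = 1` (provable-looking by rest-field control ⇒ Newton–Kantorovich/Rouché; director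
(CA1009)(2)(b)); near-COINCIDENT multiple tops (C2 RESULT-12's only degeneration, child → circle from inside) are OUT of class at `κ₁ ≤ 1` (a mate
at distance ε inside `D⁺(T)` loads `‖(H′/H)′‖ ≈ 1/ε²`), and EXACT coincidence is branch 1 with `w := T` (`f⁽ʲ⁺¹⁾(T) = 0`, `NestedStep T T` by
`le_refl`).

EVIDENCE STATUS (float/exact on polynomial-times-exponential toy frames; NOT a proof, decides nothing about ξ): (a) as typed has NO counter-row
anywhere benched — C2 RESULT-10/12 (1+1)-ES adversary ≈ 1.4·10⁶ evaluations (≤ 3 touchers none taller, near-double tops, far mates, tooth at the Im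
T/2 edge, NO-tooth clusters, CROWDED near-top bands, |g̃| ≤ 7) 0 counter-rows at radius 2·Im T and Im T; BENCH-57 11/11 and 55/55; C6 PART 2 (all
tilts, exact) dichotomy ∀g̃ on every custody configuration; C6 PART 3 (two-toucher touching family, 300 + 1530 exact configurations) dichotomy ∀g̃
1830/1830, the only un-nested rows (6 edge configurations on two thin tilt slivers) all with an NL event at `≤ Im T`; `κ₁ ≤ 1` on 469/1530 of that
family (the reach of (ii) at `κ₁ = 1` there; (a) takes all). The violating frames of record of the OLD open-disc typing (EQH-231-1864 etc.) have
their NL at 1.0005·Im T — inside branch 2. For the EXTRA scope of `ToothOnlyDichotomyQ` (toucher-free tops, deep touchers only): critic g31 floats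
(T = i, |g| ≤ 8, closed forms) 5.8·10⁵ + 3.9·10⁵ evaluations, 0 violations (un-nested only where the pair LANDS, with its NL event).

CONTENTS: §1 (ii) `ToothNestDichotomyQ θ κ₁ : Prop` (OPEN) + `dichotomy_of_umbrellaA` (119 ⇒ branch 1 under the drift datum); §2 `RestFactor4`,
(iii) `UmbrellaDichotomyQ θ κ₁ : Prop` (OPEN), `restFactor4_of_restFactor`; §3 (a) `ToothDichotomyQ θ : Prop` (OPEN) and the (K) glue — `nl_range`
(an axis point STRICTLY within `2·Im T` of a band state's foot is in the range: `abs_re_sub_le_of_stTrkDQ`, `Im T ≤ Hs`, `2·Hs ≤ R`, `√j ≤ j`; the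
`j = 0` corner `Re T ± 2·Im T` is why the law carries the range conjunct), `nl_branch_of_strict`, `nl_branch_absurd` (an NL event in range is
`TiltReady` ⇒ `ReadyR2` at every state, `RhW08.Round2.readyR2_of_tiltReady`), `nl_branch_absurd_window` (tenure's radius-`Im T` door
`RhW08.Lens1PinningTol.readyR2_of_band_window_nl` by name), ★ `succ_of_toothDichotomy` : (a′) ⇒ inside 2′ (`¬ ReadyR2 … j v`) the toothed
NT-umbrella configuration under a band state `T` yields `∃ u, StTrkDQ … (j+1) u` (branch 1 by `RhW08.SuccB.stTrkDQ_succ_of_nested`, branch 2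
absurd), `succ_of_umbrellaLowNT_nearTooth` (the same read off tenure's `UmbrellaLowNT θ` datum spelled out `∃ T b, …` plus a near tooth — the first
branch of 119's `umbrella_dispatch`), `ToothOnlyDichotomyQ : Prop` (OPEN, stronger) with `toothDichotomyQ_of_toothOnly` and
`succ_of_toothOnlyDichotomy` (★ ∘ it), `succ_of_toothNestDichotomy` / `succ_of_umbrellaDichotomy` (the pair's dispatchers, same two doors); census 5
`def` + 12 theorems. SIZING OF RECORD UNCHANGED (stub 2′ S as typed; registry v14q′ untouched; (a′) is a CANDIDATE statement for 2′'s toothed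
umbrella sub-case, (ii)/(iii)/(N″a) its support targets, `ToothOnlyDichotomyQ` a stronger conjecture). HONEST LABEL: (a′), tooth-only, (ii), (iii)
are OPEN typed law-candidates — sentences to attack, not results; §3's theorems are K bookkeeping; nothing here bears on the truth of RH; RH is not
proved; ⟨33346⟩/⟨33347⟩ OPEN; typed ≠ checked ≠ certified ≠ landed ≠ proved.
-/

noncomputable section

open Complex Set
open scoped ComplexConjugate

namespace RhW08.Lens1ToothNestUmbrella

open RhIdea6.G17.W07C7 RhIdea6.G17.W07C7.Rev6 RhIdea6.G18.W07C8.Law421BirthS RhIdea6.G19.W07C11.Seam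
open RhW08.Round1 RhW08.StSwap RhW08.Round2 RhW08.QuadW RhW08.SuccB RhW08.SuccSplit
open RhW08.Lens1Pinning (NoTallerToucher)

/-! ## §1 (b)(ii): the TILT-ROBUST TOOTHED DICHOTOMY in the RV(κ₁) class — (N″a)'s binders MINUS the drift datum (adopted second branch) -/

/-- (N″c)(ii) `ToothNestDichotomyQ θ κ₁` (OPEN law-candidate; CERTIFIABLE SUB-CASE SUPPORT target under (a), (CA1009)(2)(b)): same binders as (N″a)
MINUS the drift datum (`d = ∞`) ⇒ a closed-nested upper zero of `f⁽ʲ⁺¹⁾` under `T` OR a Newton–Laguerre event of `f⁽ʲ⁾` on the axis in the law's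
`TiltReady` range and within `2·Im T` of `Re T` (tree `NLEventOf`, …Seam01 :258, the CLOSED sign form).  Proposed instance `κ₁ = 1`. -/
def ToothNestDichotomyQ (θ κ₁ : ℝ) : Prop :=
  ∀ (η : ℝ) (f : ℂ → ℂ) (x₀ s hmax R Hs : ℝ) (B : ℕ), EngineHyps5 2 η f x₀ s hmax R Hs B →
    ∀ (j : ℕ) (T b : ℂ) (t : ℝ) (H : ℂ → ℂ),
      0 < T.im → (1 - θ) * T.im ≤ b.im → b.im ≤ T.im → |T.re - b.re| ≤ T.im + b.im →
      |t - T.re| ≤ T.im / 2 →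
      RestFactor f j T b t H → RVClass κ₁ T H →
      (∃ w : ℂ, 0 < w.im ∧ iteratedDeriv (j + 1) f w = 0 ∧ NestedStep T w) ∨
      (∃ x : ℝ, |x - x₀| < ((j : ℝ) + 3) * R / 2 ∧ |x - T.re| ≤ 2 * T.im ∧ NLEventOf f j x)

/-- (N″a) (TREE, 119) at any `d` implies the dichotomy's first branch whenever the drift datum holds — bookkeeping only. -/
theorem dichotomy_of_umbrellaA {θ κ₁ d : ℝ} (hN : ToothNestUmbrellaAQ θ κ₁ d)
    {η : ℝ} {f : ℂ → ℂ} {x₀ s hmax R Hs : ℝ} {B j : ℕ} {T b : ℂ} {t : ℝ} {H : ℂ → ℂ}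
    (hE : EngineHyps5 2 η f x₀ s hmax R Hs B) (hT : 0 < T.im)
    (hb1 : (1 - θ) * T.im ≤ b.im) (hb2 : b.im ≤ T.im) (htouch : |T.re - b.re| ≤ T.im + b.im) (hnear : |t - T.re| ≤ T.im / 2)
    (hH : RestFactor f j T b t H) (hRV : RVClass κ₁ T H) (hdrift : T.im * ‖deriv H (p₃ T t) / H (p₃ T t)‖ ≤ d) :
    (∃ w : ℂ, 0 < w.im ∧ iteratedDeriv (j + 1) f w = 0 ∧ NestedStep T w) ∨
      (∃ x : ℝ, |x - x₀| < ((j : ℝ) + 3) * R / 2 ∧ |x - T.re| ≤ 2 * T.im ∧ NLEventOf f j x) :=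
  Or.inl (hN η f x₀ s hmax R Hs B hE j T b t H hT hb1 hb2 htouch hnear hH hRV hdrift)

/-! ## §2 (b)(iii): the TOOTH-FREE umbrella dichotomy in the RV(κ₁) class (four-body rest factor; adopted second branch) -/

/-- REST FACTOR without a tooth: `H` entire and `f⁽ʲ⁾ = (z − T)(z − T̄)(z − b)(z − b̄)·H`. -/
def RestFactor4 (f : ℂ → ℂ) (j : ℕ) (T b : ℂ) (H : ℂ → ℂ) : Prop :=
  Differentiable ℂ H ∧ ∀ z : ℂ, iteratedDeriv j f z = (z - T) * (z - conj T) * (z - b) * (z - conj b) * H z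

/-- (N″c)(iii) `UmbrellaDichotomyQ θ κ₁` (OPEN law-candidate; CERTIFIABLE SUB-CASE SUPPORT target under (a)): θ-band partner `b` touching `T`'s closed
disc, rest factor in RV(κ₁) on `D⁺(T)`, NO tooth, NO drift datum ⇒ closed-nested upper zero of `f⁽ʲ⁺¹⁾` under `T` OR an NL event of `f⁽ʲ⁾` in the
range and within `2·Im T` of `Re T`.  (A real zero `t` of `f⁽ʲ⁾`, if present, is part of `H`; `RVClass` keeps it out of `D⁺(T)` only through the
variation bound — (ii) and (iii) partition the toothed configurations by tooth distance at `κ₁ = 1`.) -/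
def UmbrellaDichotomyQ (θ κ₁ : ℝ) : Prop :=
  ∀ (η : ℝ) (f : ℂ → ℂ) (x₀ s hmax R Hs : ℝ) (B : ℕ), EngineHyps5 2 η f x₀ s hmax R Hs B →
    ∀ (j : ℕ) (T b : ℂ) (H : ℂ → ℂ),
      0 < T.im → (1 - θ) * T.im ≤ b.im → b.im ≤ T.im → |T.re - b.re| ≤ T.im + b.im →
      RestFactor4 f j T b H → RVClass κ₁ T H →
      (∃ w : ℂ, 0 < w.im ∧ iteratedDeriv (j + 1) f w = 0 ∧ NestedStep T w) ∨
      (∃ x : ℝ, |x - x₀| < ((j : ℝ) + 3) * R / 2 ∧ |x - T.re| ≤ 2 * T.im ∧ NLEventOf f j x)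

/-- Bookkeeping: a five-body rest factor with tooth `t` is a four-body rest factor with `H₄ := (z − t)·H`. -/
theorem restFactor4_of_restFactor {f : ℂ → ℂ} {j : ℕ} {T b : ℂ} {t : ℝ} {H : ℂ → ℂ} (h : RestFactor f j T b t H) :
    RestFactor4 f j T b (fun z => (z - t) * H z) :=
  ⟨(differentiable_id.sub (differentiable_const _)).mul h.1, fun z => by rw [h.2 z]; ring⟩

/-! ## §3 (a′): the LAW-CANDIDATE OF RECORD «ToothDichotomy», the stronger TOOTH-ONLY conjecture, and the (K) dispatchers -/

/-- ★ (N″c)(a′) `ToothDichotomyQ θ` — LAW-CANDIDATE OF RECORD for 2′'s umbrella sub-case (C2 RESULT-10/11 typing; (CA1009)(2)(a), wording (CA1010),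
v2 binders (CA1028)(2)/(CA1029); OPEN): binders = literally 2′-NT's near-tooth sub-case — legal frame, `T` a level-`j` band state with every level-`j`
band state of height `≤ Im T`, NO strictly taller toucher (scope clause, not used by the dispatcher), a θ-low toucher `b` with ALL the `UmbrellaLow θ`
partner clauses (`f⁽ʲ⁾ b = 0`, `(1−θ)·Im T ≤ Im b ≤ Im T`, touching, `¬ StTrkDQ … j b`, `PinnedTopAt f j b` — so `b ≠ T` and θ bites), a tooth `t`
with `|t − Re T| ≤ Im T/2` (scope clause) ⇒ a closed-nested upper zero of `f⁽ʲ⁺¹⁾` under `T` OR an NL event of `f⁽ʲ⁾` in the `TiltReady` range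
`|x − x₀| < (j+3)·R/2` within `2·Im T` of `Re T` (radius = scope clause).  NO drift window, NO RV class, NO anchor.  A cluster law of 1′/2′ type
(S-typed), not an M lemma; (ii)/(iii) above are its certifiable sub-cases; `ToothOnlyDichotomyQ` below is the stronger partner-free conjecture. -/
def ToothDichotomyQ (θ : ℝ) : Prop :=
  ∀ (η : ℝ) (f : ℂ → ℂ) (x₀ s hmax R Hs : ℝ) (B : ℕ), EngineHyps5 2 η f x₀ s hmax R Hs B →
    ∀ (j : ℕ) (T b : ℂ) (t : ℝ),
      StTrkDQ η f x₀ s hmax R Hs B j T → (∀ w : ℂ, StTrkDQ η f x₀ s hmax R Hs B j w → w.im ≤ T.im) → NoTallerToucher f j T →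
      iteratedDeriv j f b = 0 → (1 - θ) * T.im ≤ b.im → b.im ≤ T.im → |T.re - b.re| ≤ T.im + b.im →
      ¬ StTrkDQ η f x₀ s hmax R Hs B j b → RhW08.Lens1TopChild.PinnedTopAt f j b →
      iteratedDeriv j f t = 0 → |t - T.re| ≤ T.im / 2 →
      (∃ w : ℂ, 0 < w.im ∧ iteratedDeriv (j + 1) f w = 0 ∧ NestedStep T w) ∨
      (∃ x : ℝ, |x - x₀| < ((j : ℝ) + 3) * R / 2 ∧ |x - T.re| ≤ 2 * T.im ∧ NLEventOf f j x)

/-- (K) RANGE NOTE: an axis point STRICTLY within `2·Im T` of the foot of a level-`j` band state `T` lies in the law's `TiltReady` range `|x − x₀| <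
(j+3)·R/2` — `abs_re_sub_le_of_stTrkDQ` (`|Re T − x₀| ≤ R/2 + √j·Hs`), `Im T ≤ Hs`, `2·Hs ≤ R` and `√j ≤ j` (`j ≤ j²` for naturals).  So a prover
who reaches the strict radius has the adopted range conjunct for free; only the `j = 0` corner `x = Re T ± 2·Im T` is not covered by the radius. -/
theorem nl_range {η : ℝ} {f : ℂ → ℂ} {x₀ s hmax R Hs : ℝ} {B j : ℕ} {T : ℂ} {x : ℝ}
    (hE : EngineHyps5 2 η f x₀ s hmax R Hs B) (hT : StTrkDQ η f x₀ s hmax R Hs B j T) (hx : |x - T.re| < 2 * T.im) :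
    |x - x₀| < ((j : ℝ) + 3) * R / 2 := by
  have hHs : 0 ≤ Hs := hE.2.2.2.2.2.2.2.1
  have h2Hs : 2 * Hs ≤ R := hE.2.2.2.2.2.2.2.2.2.1
  have hre := abs_re_sub_le_of_stTrkDQ hHs hT
  have hTim : T.im ≤ Hs := hT.2.2.2.2
  have hj : (0 : ℝ) ≤ (j : ℝ) := Nat.cast_nonneg j
  have hjsq : (j : ℝ) ≤ (j : ℝ) ^ 2 := by exact_mod_cast Nat.le_self_pow two_ne_zero j
  have hs : Real.sqrt j ≤ (j : ℝ) := by rw [Real.sqrt_le_left hj]; exact hjsq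
  have h1 : Real.sqrt j * Hs ≤ (j : ℝ) * Hs := mul_le_mul_of_nonneg_right hs hHs
  have h2 : (j : ℝ) * (2 * Hs) ≤ (j : ℝ) * R := mul_le_mul_of_nonneg_left h2Hs hj
  calc |x - x₀| ≤ |x - T.re| + |T.re - x₀| := abs_sub_le x T.re x₀
    _ < 2 * T.im + (R / 2 + Real.sqrt j * Hs) := add_lt_add_of_lt_of_le hx hre
    _ ≤ ((j : ℝ) + 3) * R / 2 := by linarith

/-- (K) the strict-radius form of the NL branch implies the adopted one (by `nl_range`). -/
theorem nl_branch_of_strict {η : ℝ} {f : ℂ → ℂ} {x₀ s hmax R Hs : ℝ} {B j : ℕ} {T : ℂ}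
    (hE : EngineHyps5 2 η f x₀ s hmax R Hs B) (hT : StTrkDQ η f x₀ s hmax R Hs B j T)
    (h : ∃ x : ℝ, |x - T.re| < 2 * T.im ∧ NLEventOf f j x) :
    ∃ x : ℝ, |x - x₀| < ((j : ℝ) + 3) * R / 2 ∧ |x - T.re| ≤ 2 * T.im ∧ NLEventOf f j x := by
  obtain ⟨x, hx, hNL⟩ := h
  exact ⟨x, nl_range hE hT hx, hx.le, hNL⟩

/-- (K) inside 2′ the NL branch is EMPTY — an NL event in the law's range is `TiltReady`, hence `ReadyR2` at every state, against 2′'s binder. -/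
theorem nl_branch_absurd {η : ℝ} {f : ℂ → ℂ} {x₀ s hmax R Hs : ℝ} {B j : ℕ} {v : ℂ} {x : ℝ}
    (hnR : ¬ ReadyR2 η f x₀ s hmax R Hs B j v) (hx : |x - x₀| < ((j : ℝ) + 3) * R / 2) (hNL : NLEventOf f j x) : False :=
  hnR (readyR2_of_tiltReady ⟨x, hx, hNL⟩)

/-- (K) the radius-`Im T` sub-branch by tenure's door BY NAME (`readyR2_of_band_window_nl`, #1256 :89) — for the record. -/
theorem nl_branch_absurd_window {η : ℝ} {f : ℂ → ℂ} {x₀ s hmax R Hs : ℝ} {B j : ℕ} {T v : ℂ} {x : ℝ}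
    (hE : EngineHyps5 2 η f x₀ s hmax R Hs B) (hT : StTrkDQ η f x₀ s hmax R Hs B j T) (hnR : ¬ ReadyR2 η f x₀ s hmax R Hs B j v)
    (hx : |x - T.re| ≤ T.im) (hNL : NLEventOf f j x) : False :=
  hnR (RhW08.Lens1PinningTol.readyR2_of_band_window_nl hE hT hx hNL v)

/-- ★ (K) DISPATCH of the law-candidate (a′) inside 2′ (v2: the umbrella datum's `¬ StTrkDQ … j b`, `PinnedTopAt f j b` are passed to the law): given
`¬ ReadyR2 … j v`, the NL branch is absurd (`readyR2_of_tiltReady` on the range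
conjunct) and the nested branch is a level-(j+1) band state (`stTrkDQ_succ_of_nested`). -/
theorem succ_of_toothDichotomy {θ : ℝ} (hN : ToothDichotomyQ θ)
    {η : ℝ} {f : ℂ → ℂ} {x₀ s hmax R Hs : ℝ} {B j : ℕ} {T b v : ℂ} {t : ℝ}
    (hE : EngineHyps5 2 η f x₀ s hmax R Hs B) (hT : StTrkDQ η f x₀ s hmax R Hs B j T)
    (htall : ∀ w : ℂ, StTrkDQ η f x₀ s hmax R Hs B j w → w.im ≤ T.im) (hNT : NoTallerToucher f j T)
    (hb0 : iteratedDeriv j f b = 0) (hb1 : (1 - θ) * T.im ≤ b.im) (hb2 : b.im ≤ T.im) (htouch : |T.re - b.re| ≤ T.im + b.im)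
    (hnb : ¬ StTrkDQ η f x₀ s hmax R Hs B j b) (hpin : RhW08.Lens1TopChild.PinnedTopAt f j b)
    (ht0 : iteratedDeriv j f t = 0) (hnear : |t - T.re| ≤ T.im / 2)
    (hnR : ¬ ReadyR2 η f x₀ s hmax R Hs B j v) :
    ∃ u : ℂ, StTrkDQ η f x₀ s hmax R Hs B (j + 1) u := by
  rcases hN η f x₀ s hmax R Hs B hE j T b t hT htall hNT hb0 hb1 hb2 htouch hnb hpin ht0 hnear with ⟨w, hwim, hw0, hn⟩ | ⟨x, hxr, -, hNL⟩
  · exact ⟨w, stTrkDQ_succ_of_nested hE hT hw0 hwim hn⟩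
  · exact (nl_branch_absurd hnR hxr hNL).elim

/-- (K) The same dispatch read off the NT-umbrella DATUM (tenure's drawer `UmbrellaLowNT θ` spelled out: `UmbrellaLow θ` (#1256 :108) with the
tallest band state carrying `NoTallerToucher`) plus a NEAR tooth under that `T` (the first branch of `umbrella_dispatch`, TREE 119 §3). -/
theorem succ_of_umbrellaLowNT_nearTooth {θ : ℝ} (hN : ToothDichotomyQ θ)
    {η : ℝ} {f : ℂ → ℂ} {x₀ s hmax R Hs : ℝ} {B j : ℕ} {v : ℂ}
    (hE : EngineHyps5 2 η f x₀ s hmax R Hs B) (hnR : ¬ ReadyR2 η f x₀ s hmax R Hs B j v)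
    (hU : ∃ T b : ℂ, StTrkDQ η f x₀ s hmax R Hs B j T ∧ (∀ w : ℂ, StTrkDQ η f x₀ s hmax R Hs B j w → w.im ≤ T.im) ∧
      NoTallerToucher f j T ∧
      iteratedDeriv j f b = 0 ∧ (1 - θ) * T.im ≤ b.im ∧ b.im ≤ T.im ∧ |T.re - b.re| ≤ T.im + b.im ∧
      ¬ StTrkDQ η f x₀ s hmax R Hs B j b ∧ RhW08.Lens1TopChild.PinnedTopAt f j b ∧
      ∃ t : ℝ, iteratedDeriv j f (t : ℂ) = 0 ∧ |t - T.re| ≤ T.im / 2) :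
    ∃ u : ℂ, StTrkDQ η f x₀ s hmax R Hs B (j + 1) u := by
  obtain ⟨T, b, hT, htall, hNT, hb0, hb1, hb2, htouch, hnb, hpin, t, ht0, hnear⟩ := hU
  exact succ_of_toothDichotomy hN hE hT htall hNT hb0 hb1 hb2 htouch hnb hpin ht0 hnear hnR

/-- ★ THE STRONGER CONJECTURE «TOOTH-ONLY dichotomy» `ToothOnlyDichotomyQ` (critic g31's reading of v1, named; OPEN; θ-free, partner-free): legal
frame, `T` a tallest level-`j` band state with NO strictly taller toucher (equal-height and lower touchers, overlapping discs, NO toucher at all —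
all allowed), a real zero `t` of `f⁽ʲ⁾` with `|t − Re T| ≤ Im T/2` ⇒ closed-nested upper zero of `f⁽ʲ⁺¹⁾` under `T` ∨ NL event in range within
`2·Im T`.  It IMPLIES (a′) (`toothDichotomyQ_of_toothOnly`); evidence = the (a′) benches plus critic's toucher-free / deep-toucher float families. -/
def ToothOnlyDichotomyQ : Prop :=
  ∀ (η : ℝ) (f : ℂ → ℂ) (x₀ s hmax R Hs : ℝ) (B : ℕ), EngineHyps5 2 η f x₀ s hmax R Hs B →
    ∀ (j : ℕ) (T : ℂ) (t : ℝ),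
      StTrkDQ η f x₀ s hmax R Hs B j T → (∀ w : ℂ, StTrkDQ η f x₀ s hmax R Hs B j w → w.im ≤ T.im) → NoTallerToucher f j T →
      iteratedDeriv j f t = 0 → |t - T.re| ≤ T.im / 2 →
      (∃ w : ℂ, 0 < w.im ∧ iteratedDeriv (j + 1) f w = 0 ∧ NestedStep T w) ∨
      (∃ x : ℝ, |x - x₀| < ((j : ℝ) + 3) * R / 2 ∧ |x - T.re| ≤ 2 * T.im ∧ NLEventOf f j x)

/-- (K) the tooth-only conjecture implies the law of record (a′) at every θ (ignore the partner `b`). -/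
theorem toothDichotomyQ_of_toothOnly (h : ToothOnlyDichotomyQ) (θ : ℝ) : ToothDichotomyQ θ := by
  intro η f x₀ s hmax R Hs B hE j T b t hT htall hNT _ _ _ _ _ _ ht0 hnear
  exact h η f x₀ s hmax R Hs B hE j T t hT htall hNT ht0 hnear

/-- (K) DISPATCH of the tooth-only conjecture inside 2′ (= ★ ∘ `toothDichotomyQ_of_toothOnly`, stated partner-free). -/
theorem succ_of_toothOnlyDichotomy (hN : ToothOnlyDichotomyQ)
    {η : ℝ} {f : ℂ → ℂ} {x₀ s hmax R Hs : ℝ} {B j : ℕ} {T v : ℂ} {t : ℝ}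
    (hE : EngineHyps5 2 η f x₀ s hmax R Hs B) (hT : StTrkDQ η f x₀ s hmax R Hs B j T)
    (htall : ∀ w : ℂ, StTrkDQ η f x₀ s hmax R Hs B j w → w.im ≤ T.im) (hNT : NoTallerToucher f j T)
    (ht0 : iteratedDeriv j f t = 0) (hnear : |t - T.re| ≤ T.im / 2)
    (hnR : ¬ ReadyR2 η f x₀ s hmax R Hs B j v) :
    ∃ u : ℂ, StTrkDQ η f x₀ s hmax R Hs B (j + 1) u := by
  rcases hN η f x₀ s hmax R Hs B hE j T t hT htall hNT ht0 hnear with ⟨w, hwim, hw0, hn⟩ | ⟨x, hxr, -, hNL⟩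
  · exact ⟨w, stTrkDQ_succ_of_nested hE hT hw0 hwim hn⟩
  · exact (nl_branch_absurd hnR hxr hNL).elim

/-- (K) DISPATCH of (b)(ii) inside 2′ (rest-factor data supplied by the caller; TREE `restFactor_of_zeros` gives `H`, the class is the caller's). -/
theorem succ_of_toothNestDichotomy {θ κ₁ : ℝ} (hN : ToothNestDichotomyQ θ κ₁)
    {η : ℝ} {f : ℂ → ℂ} {x₀ s hmax R Hs : ℝ} {B j : ℕ} {T b v : ℂ} {t : ℝ} {H : ℂ → ℂ}
    (hE : EngineHyps5 2 η f x₀ s hmax R Hs B) (hT : StTrkDQ η f x₀ s hmax R Hs B j T)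
    (hb1 : (1 - θ) * T.im ≤ b.im) (hb2 : b.im ≤ T.im) (htouch : |T.re - b.re| ≤ T.im + b.im) (hnear : |t - T.re| ≤ T.im / 2)
    (hH : RestFactor f j T b t H) (hRV : RVClass κ₁ T H)
    (hnR : ¬ ReadyR2 η f x₀ s hmax R Hs B j v) :
    ∃ u : ℂ, StTrkDQ η f x₀ s hmax R Hs B (j + 1) u := by
  rcases hN η f x₀ s hmax R Hs B hE j T b t H hT.2.2.1 hb1 hb2 htouch hnear hH hRV with ⟨w, hwim, hw0, hn⟩ | ⟨x, hxr, -, hNL⟩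
  · exact ⟨w, stTrkDQ_succ_of_nested hE hT hw0 hwim hn⟩
  · exact (nl_branch_absurd hnR hxr hNL).elim

/-- (K) DISPATCH of (b)(iii) inside 2′ (four-body rest factor; no tooth). -/
theorem succ_of_umbrellaDichotomy {θ κ₁ : ℝ} (hN : UmbrellaDichotomyQ θ κ₁)
    {η : ℝ} {f : ℂ → ℂ} {x₀ s hmax R Hs : ℝ} {B j : ℕ} {T b v : ℂ} {H : ℂ → ℂ}
    (hE : EngineHyps5 2 η f x₀ s hmax R Hs B) (hT : StTrkDQ η f x₀ s hmax R Hs B j T)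
    (hb1 : (1 - θ) * T.im ≤ b.im) (hb2 : b.im ≤ T.im) (htouch : |T.re - b.re| ≤ T.im + b.im)
    (hH : RestFactor4 f j T b H) (hRV : RVClass κ₁ T H)
    (hnR : ¬ ReadyR2 η f x₀ s hmax R Hs B j v) :
    ∃ u : ℂ, StTrkDQ η f x₀ s hmax R Hs B (j + 1) u := by
  rcases hN η f x₀ s hmax R Hs B hE j T b H hT.2.2.1 hb1 hb2 htouch hH hRV with ⟨w, hwim, hw0, hn⟩ | ⟨x, hxr, -, hNL⟩
  · exact ⟨w, stTrkDQ_succ_of_nested hE hT hw0 hwim hn⟩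
  · exact (nl_branch_absurd hnR hxr hNL).elim

end RhW08.Lens1ToothNestUmbrella
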